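import Summits.ResolutionOfSingularities.ResolutionOfSingularities.Theorems.FrobeniusClosingPatchingRelPerfectDepthParamLiftChartPresentation
import HarnessLib

/-!
# Crux `PatchingRelPerfect` (stmt-ResolutionOfSingularities-16161), chain W5.2 — F7(β) d = 2 (β-AX), X2a module 2 (M2c), e-chart step E5 (i):
# inputs of the assembly — the carrier rsop at a carrier point, and the chart presentation with the chart-index identities

[OURS · L1 W5.2 · F7(β) (β-AX) X-side · res-D-pv-034 AS res-L1-s36-pv-3 per res-L1-w52-plan-1 RULING G11-21 ((M2c) PARAM
PROPAGATION, e-chart half; blueprint `D/res-D-pv-034/M2C-ECHART-BLUEPRINT.md`).]  Replaces the role of NO printed item; NOT a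
statement of the manuscript under review; fact-free, def-free.  AI-written; AI review is weaker than expert review.

* `CylState.isRsopPart_cons_carrier` — at a carrier point `y` of the cylinder region, for a local equation `t` of the carrier and a
  part `a` of a regular system of parameters of `𝒪_{Z,q y}`: `(t, q^♯ a)` is part of a regular system of parameters of `𝒪_{V,y}`
  (section argument of `…CylSnc`).
* `CylState.exists_chartPresentation₂` — `exists_chartPresentation` (`…ChartPresentation`) with the two chart-index identities
  `stalkIdeal (𝓘(jV(C))^*τ) (ι y′) = (τ^♯ cX_{l+1})`, `stalkIdeal (C^*τZ) (r′ y′) = (τZ^♯ a_l)` exported.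

## References
* U. Görtz, T. Wedhorn, *Algebraic Geometry I* (2020), (13.19) p. 415. [GortzWedhorn2020]
* H. Matsumura, *Commutative Ring Theory* (1986), Thm. 14.2. [Matsumura1987]
-/

-- `Summit.<Summit>.<Sub>.Theorems` with `Sub = Summit` (single-conjunct summit, D-0017)
set_option linter.dupNamespace false

noncomputable section

open CategoryTheory AlgebraicGeometry TopologicalSpace IsLocalRing
open Literature.AlgebraicGeometry.Resolution
open Scheme.IdealSheafData

namespace Summit.ResolutionOfSingularities.ResolutionOfSingularities.Theorems.DepthMultiHost

universe u

namespace CylState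

variable {X : Scheme.{u}} {S : MultiHostState X} (cyl : CylState S)

/-! ## §1 The carrier rsop `(t, q^♯ a)` -/

/-- **`(t, q^♯ a)` is part of a regular system of parameters of `𝒪_{V,y}`** at a carrier point `y`, for a local equation `t` of
the carrier and a part `a` of a regular system of parameters of `𝒪_{Z,q y}` (section argument). [cite: Matsumura1987, Thm. 14.2] -/
theorem isRsopPart_cons_carrier (y : (cyl.V : Scheme.{u})) (hy : y ∈ (cyl.j.ker.comap cyl.V.ι).support)
    {t : (cyl.V : Scheme.{u}).presheaf.stalk y} (ht : stalkIdeal (cyl.j.ker.comap cyl.V.ι) y = Ideal.span {t})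
    {c : ℕ} {a : Fin c → cyl.Z.presheaf.stalk (cyl.q y)} (ha : IsRsopPart a) :
    IsRsopPart (Fin.cons t (fun i => (cyl.q.stalkMap y).hom (a i)) : Fin (c + 1) → (cyl.V : Scheme.{u}).presheaf.stalk y) := by
  classical
  obtain ⟨z₀, rfl⟩ := (cyl.mem_support_carrier_iff y).mp hy
  haveI hB : IsRegularLocalRing ((cyl.V : Scheme.{u}).presheaf.stalk (cyl.jV z₀)) := cyl.isRegularLocalRing_stalk_V _
  obtain ⟨t₀, ht₀0, ht₀m, hst₀, hker⟩ := cyl.exists_carrier_equation z₀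
  set σ : cyl.Z.presheaf.stalk (cyl.q (cyl.jV z₀)) →+* (cyl.V : Scheme.{u}).presheaf.stalk (cyl.jV z₀) :=
    (cyl.q.stalkMap (cyl.jV z₀)).hom with hσ
  set π' : (cyl.V : Scheme.{u}).presheaf.stalk (cyl.jV z₀) →+* cyl.Z.presheaf.stalk z₀ := (cyl.jV.stalkMap z₀).hom with hπ'
  have hiso : IsIso ((cyl.jV ≫ cyl.q).stalkMap z₀) := by
    rw [cyl.retract, Scheme.Hom.stalkMap_id]; exact IsIso.id _
  have hcomp : ((cyl.jV ≫ cyl.q).stalkMap z₀).hom = π'.comp σ := by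
    rw [Scheme.Hom.stalkMap_comp]; rfl
  have hbij : Function.Bijective (π'.comp σ) := by
    rw [← hcomp]; exact (asIso ((cyl.jV ≫ cyl.q).stalkMap z₀)).commRingCatIsoToRingEquiv.bijective
  have hmax := maximalIdeal_eq_span_sup_map_of_section σ π' hbij hker ht₀m
  have hsurj : Function.Surjective π' := Function.Surjective.of_comp (g := σ) hbij.2
  have hdimB := ringKrullDim_eq_of_section π' hsurj hker ht₀m ht₀0
  have hdimZ : ringKrullDim (cyl.Z.presheaf.stalk z₀) = ringKrullDim (cyl.Z.presheaf.stalk (cyl.q (cyl.jV z₀))) :=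
    (ringKrullDim_eq_of_ringEquiv (RingEquiv.ofBijective (π'.comp σ) hbij)).symm
  obtain ⟨hA, e, w, hdimA, hspanA⟩ := id ha
  -- `t` and `t₀` are associated (same ideal, domain)
  haveI : IsDomain ((cyl.V : Scheme.{u}).presheaf.stalk (cyl.jV z₀)) := isDomain_of_isRegularLocalRing _
  have hassoc : Associated t₀ t := by
    rw [← Ideal.span_singleton_eq_span_singleton, ← hst₀, ht]
  have h0 : IsRsopPart (Fin.cons t₀ (fun i => σ (a i)) : Fin (c + 1) → _) := by
    refine ⟨hB, e, σ ∘ w, ?_, ?_⟩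
    · rw [hdimB, hdimZ, hdimA, show c + 1 + e = (c + e) + 1 by omega, Nat.cast_succ]
    · rw [Fin.range_cons, Set.insert_union, Ideal.span_insert, show (Set.range fun i => σ (a i)) = σ '' Set.range a from
        (Set.range_comp σ a), Set.range_comp, ← Set.image_union, ← Ideal.map_span, hspanA, hmax]
  refine h0.of_associated fun i => ?_
  refine Fin.cases ?_ (fun j => ?_) i
  · simpa using hassoc
  · simp

/-! ## §2 The chart presentation with the chart-index identities -/

section Presentation

variable {X' Z' : Scheme.{u}} (C : cyl.Z.IdealSheafData) {τ : X' ⟶ X} (hτ : IsBlowup τ (vanishingIdeal (cyl.centre C)))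
  {τZ : Z' ⟶ cyl.Z} (hτZ : IsBlowup τZ C) {V' : X'.Opens} (r' : (V' : Scheme.{u}) ⟶ Z')
  (φ : (V' : Scheme.{u}) ⟶ (cyl.V : Scheme.{u})) (hφ : φ ≫ cyl.V.ι = V'.ι ≫ τ) (hr'τ : r' ≫ τZ = φ ≫ cyl.q)
  (hexc : (C.comap τZ).comap r' = ((vanishingIdeal (cyl.centre C)).comap τ).comap V'.ι) (y' : (V' : Scheme.{u}))

include hτ hτZ hφ hr'τ hexc in
set_option maxHeartbeats 800000 in -- two `blowupAlgebra` chart presentations (subalgebras of localisations): slow instance unification (cf. p537631, which needs 400000 for ONE)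
/-- [OURS · L1 W5.2 · F7(β) (β-AX) M2c, E1b/E1c] **The two stalk presentations at an e-chart point and the map between them**, with
the two chart-index identities exported (`exists_chartPresentation` of `…ChartPresentation` re-proved with two more conjuncts). [cite: GortzWedhorn2020, (13.19) p. 415] [cite: StacksProject, Tag 0804] -/
theorem exists_chartPresentation₂ (𝓕 : List cyl.Z.IdealSheafData) (h𝓕 : HasSNCWith 𝓕 C)
    (hy : τ (V'.ι y') ∈ (cyl.centre C : Set X))
    {c : ℕ} (a : Fin c → cyl.Z.presheaf.stalk (cyl.q (φ y'))) (ha : Ideal.span (Set.range a) = stalkIdeal C (cyl.q (φ y'))) :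
    ∃ (l : Fin c) (t : (cyl.V : Scheme.{u}).presheaf.stalk (φ y'))
      (cX : Fin (c + 1) → X.presheaf.stalk (cyl.V.ι (φ y')))
      (𝔔A : PrimeSpectrum (blowupAlgebra (Ideal.span (Set.range a)) (a l)))
      (χA : blowupAlgebra (Ideal.span (Set.range a)) (a l) →+* Z'.presheaf.stalk (r' y'))
      (𝔔B : PrimeSpectrum (blowupAlgebra (Ideal.span (Set.range cX)) (cX l.succ)))
      (χB : blowupAlgebra (Ideal.span (Set.range cX)) (cX l.succ) →+* X'.presheaf.stalk (V'.ι y'))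
      (ψ : blowupAlgebra (Ideal.span (Set.range a)) (a l) →+* blowupAlgebra (Ideal.span (Set.range cX)) (cX l.succ)),
      stalkIdeal (cyl.j.ker.comap cyl.V.ι) (φ y') = Ideal.span {t} ∧
      (cX = fun m => (asIso (cyl.V.ι.stalkMap (φ y'))).commRingCatIsoToRingEquiv.symm
          ((Fin.cons t (fun i => (cyl.q.stalkMap (φ y')).hom (a i)) :
            Fin (c + 1) → (cyl.V : Scheme.{u}).presheaf.stalk (φ y')) m)) ∧
      Ideal.span (Set.range cX) = stalkIdeal (vanishingIdeal (cyl.centre C)) (cyl.V.ι (φ y')) ∧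
      stalkIdeal ((vanishingIdeal (cyl.centre C)).comap τ) (V'.ι y') =
        Ideal.span {((X.presheaf.stalkCongr (.of_eq (cyl.τ_ι_eq φ hφ y'))).inv ≫ τ.stalkMap (V'.ι y')).hom (cX l.succ)} ∧
      stalkIdeal (C.comap τZ) (r' y') =
        Ideal.span {((cyl.Z.presheaf.stalkCongr (.of_eq (cyl.τZ_r_eq r' φ hr'τ y'))).inv ≫ τZ.stalkMap (r' y')).hom (a l)} ∧
      (∀ x, χA (algebraMap _ _ x) =
        ((cyl.Z.presheaf.stalkCongr (.of_eq (cyl.τZ_r_eq r' φ hr'τ y'))).inv ≫ τZ.stalkMap (r' y')).hom x) ∧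
      @IsLocalization.AtPrime _ _ (Z'.presheaf.stalk (r' y')) _ χA.toAlgebra 𝔔A.asIdeal _ ∧
      𝔔A.asIdeal.comap (algebraMap _ (blowupAlgebra (Ideal.span (Set.range a)) (a l))) =
        maximalIdeal (cyl.Z.presheaf.stalk (cyl.q (φ y'))) ∧
      (∀ b, χB (algebraMap _ _ b) =
        ((X.presheaf.stalkCongr (.of_eq (cyl.τ_ι_eq φ hφ y'))).inv ≫ τ.stalkMap (V'.ι y')).hom b) ∧
      @IsLocalization.AtPrime _ _ (X'.presheaf.stalk (V'.ι y')) _ χB.toAlgebra 𝔔B.asIdeal _ ∧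
      𝔔B.asIdeal.comap (algebraMap _ (blowupAlgebra (Ideal.span (Set.range cX)) (cX l.succ))) =
        maximalIdeal (X.presheaf.stalk (cyl.V.ι (φ y'))) ∧
      (∀ x, ψ (algebraMap _ _ x) =
        algebraMap _ _ ((asIso (cyl.V.ι.stalkMap (φ y'))).commRingCatIsoToRingEquiv.symm ((cyl.q.stalkMap (φ y')).hom x))) ∧
      χB.comp ψ = ((asIso (V'.ι.stalkMap y')).commRingCatIsoToRingEquiv.symm.toRingHom.comp (r'.stalkMap y').hom).comp χA := by
  classical
  -- notation
  set ε : X.presheaf.stalk (cyl.V.ι (φ y')) ≃+* (cyl.V : Scheme.{u}).presheaf.stalk (φ y') :=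
    (asIso (cyl.V.ι.stalkMap (φ y'))).commRingCatIsoToRingEquiv with hε
  set ε' : X'.presheaf.stalk (V'.ι y') ≃+* (V' : Scheme.{u}).presheaf.stalk y' :=
    (asIso (V'.ι.stalkMap y')).commRingCatIsoToRingEquiv with hε'
  set σ : cyl.Z.presheaf.stalk (cyl.q (φ y')) →+* (cyl.V : Scheme.{u}).presheaf.stalk (φ y') :=
    (cyl.q.stalkMap (φ y')).hom with hσ
  set ρ : cyl.Z.presheaf.stalk (cyl.q (φ y')) →+* Z'.presheaf.stalk (r' y') :=
    ((cyl.Z.presheaf.stalkCongr (.of_eq (cyl.τZ_r_eq r' φ hr'τ y'))).inv ≫ τZ.stalkMap (r' y')).hom with hρ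
  set θ : X.presheaf.stalk (cyl.V.ι (φ y')) →+* X'.presheaf.stalk (V'.ι y') :=
    ((X.presheaf.stalkCongr (.of_eq (cyl.τ_ι_eq φ hφ y'))).inv ≫ τ.stalkMap (V'.ι y')).hom with hθ
  set rr : Z'.presheaf.stalk (r' y') →+* (V' : Scheme.{u}).presheaf.stalk y' := (r'.stalkMap y').hom with hrr
  -- the carrier point `φ y′` and the generators of the pushed centre there
  have hyV : φ y' ∈ (cyl.j.ker.comap cyl.V.ι).support := by
    haveI := cyl.closedImmersion
    rw [support_comap]
    show cyl.V.ι (φ y') ∈ (cyl.j.ker.support : Set X)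
    rw [Scheme.Hom.support_ker, cyl.j.isClosedEmbedding.isClosed_range.closure_eq, ← cyl.τ_ι_eq φ hφ y']
    exact cyl.centre_subset_range C hy
  obtain ⟨t, ht, hgen⟩ := cyl.exists_centre_generators C 𝓕 h𝓕 (φ y') hyV a ha
  set cX : Fin (c + 1) → X.presheaf.stalk (cyl.V.ι (φ y')) :=
    fun m => ε.symm ((Fin.cons t (fun i => σ (a i)) : Fin (c + 1) → (cyl.V : Scheme.{u}).presheaf.stalk (φ y')) m) with hcX
  have hcXsucc : ∀ i, cX (Fin.succ i) = ε.symm (σ (a i)) := fun i => by simp [hcX]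
  have hcXspan : Ideal.span (Set.range cX) = stalkIdeal (vanishingIdeal (cyl.centre C)) (cyl.V.ι (φ y')) := hgen.symm
  -- the chart index
  obtain ⟨l, hl1, hl2⟩ := cyl.exists_chartIndex C hτ hτZ r' φ hφ hr'τ hexc y' a ha
  have hl1' : stalkIdeal ((vanishingIdeal (cyl.centre C)).comap τ) (V'.ι y') = Ideal.span {θ (cX l.succ)} := by
    rw [hl1, hcXsucc]
  -- the two presentations
  obtain ⟨𝔔A, χA, -, hχA, hlocA, -, h𝔔A⟩ :=
    Cruxes.EquisingularLiftNat.Sections.exists_blowupAlgebra_stalk_ringEquiv_of_stalkIdeal_eq_span_at hτZ (r' y')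
      (cyl.q (φ y')) (cyl.τZ_r_eq r' φ hr'τ y') a ha l hl2
  obtain ⟨𝔔B, χB, -, hχB, hlocB, -, h𝔔B⟩ :=
    Cruxes.EquisingularLiftNat.Sections.exists_blowupAlgebra_stalk_ringEquiv_of_stalkIdeal_eq_span_at hτ (V'.ι y')
      (cyl.V.ι (φ y')) (cyl.τ_ι_eq φ hφ y') cX hcXspan l.succ hl1'
  -- the map `ψ = lift of ε⁻¹ ∘ σ`
  obtain ⟨ψ, hψalg⟩ := exists_blowupAlgebra_chartMap a cX (ε.symm.toRingHom.comp σ) (fun i => (hcXsucc i).symm) l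
  -- compatibility `χ_B ∘ ψ = ε′⁻¹ ∘ r′^♯ ∘ χ_A`: both extend `x ↦ θ (ε⁻¹ σ x)`, the image of `a l` being regular
  have hsq : ∀ x, ε'.symm (rr (ρ x)) = θ (ε.symm (σ x)) := fun x => by
    have h1 : rr (ρ x) = (φ.stalkMap y').hom (σ x) := cyl.stalkMap_square_r r' φ hr'τ y' x
    have h2 := cyl.stalkMap_square_φ φ hφ y' (ε.symm (σ x))
    have h3 : (cyl.V.ι.stalkMap (φ y')).hom (ε.symm (σ x)) = σ x := ε.apply_symm_apply (σ x)
    rw [h3] at h2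
    rw [h1, h2]
    exact ε'.symm_apply_apply _
  have hreg : θ (ε.symm (σ (a l))) ∈ nonZeroDivisors (X'.presheaf.stalk (V'.ι y')) := by
    obtain ⟨g, hg, hIg⟩ := hτ.isEffectiveCartier.exists_stalkIdeal_eq_span (V'.ι y')
    have h1 : Ideal.span {θ (cX l.succ)} = Ideal.span {g} := hl1'.symm.trans hIg
    rw [hcXsucc] at h1
    exact mem_nonZeroDivisors_of_span_singleton_eq h1 hg
  have hcomp : χB.comp ψ = (ε'.symm.toRingHom.comp rr).comp χA :=
    blowupAlgebra_chartMap_comp_eq a l ψ χB χA (ε'.symm.toRingHom.comp rr) (θ.comp (ε.symm.toRingHom.comp σ))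
      (fun x => by rw [hψalg, hχB]; rfl) (fun x => by
        show ε'.symm (rr (χA (algebraMap _ _ x))) = θ (ε.symm (σ x))
        rw [hχA, ← hsq]) hreg
  exact ⟨l, t, cX, 𝔔A, χA, 𝔔B, χB, ψ, ht, rfl, hcXspan, hl1', hl2, hχA, hlocA, h𝔔A, hχB, hlocB, h𝔔B,
    fun x => hψalg x, hcomp⟩

end Presentation

end CylState

end Summit.ResolutionOfSingularities.ResolutionOfSingularities.Theorems.DepthMultiHost

end
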